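import Summits.ABC.IUTFork.LDHCor312Skel
import Summits.ABC.IUTFork.Cor312IdentifiedDHWitness
import Summits.ABC.IUTFork.ForkModelNonVacuity
import HarnessLib

/-!
# F6 kernel decisions (D-0079 L-F sub-cell F6), IUTFork rows F-1898 `OutputRegions.Represented` (ForkLana)
# and F-1903 `LanaModel.MainGoal` (ForkSwitch) — LANA's (9-1) read at log-volume level, decided both ways,
# the former at GENUINE Dupuy–Hilado data

PROOF-ONLY companion (no `def`, no `structure`, no `instance`; abc-iut-c312-4 gen 9; row F-1898 lives in this
lineage's `ForkLana.lean`, p403914). The XREF table of record (w5-d145 g5, 5974af28adc2d03a) classes both rows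
OPEN ("no theorem concludes it or its negation at any instance"). They are READING hypotheses — LANA §10.5:
"(9-1) … is not manifestly false. However, we … do not have a proof of (9-1) at this time" — and are decided
here only as SCHEMAS (satisfiable / not universal), which takes no side on the disputed step:

* **F-1898** `OutputRegions.Represented` ("some admissible region has log-volume `−|log(q)|`"):
  - GENUINE positive instance `ValLine.represented_qWitness`: for the valuation-line Dupuy–Hilado datum Q of
    `Cor312IdentifiedDHWitness` (`(O_𝕃(−P_Θ))^{Ind3} := O_𝕃(−P_q)`, p427324), over ANY number field and pilot
    data, the real-number shadow of c312-3's constructed Cor-3.12 setting (`DHData.toSetting`, LDHCor312Skel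
    p407662) IS represented — by `LDHCor312Skel.representedVol_iff` Reading 1 holds iff
    `ln ν̄_𝕃((O_𝕃(−P_Θ))^{Ind3}) = −deĝ̲(P_q)`, and for datum Q the (Ind3)-region IS `O_𝕃(−P_q)` (DH Thm. 3.10.1,
    `lnνL_regionq`): "(9-1) holds exactly when the (Ind3)-enlargement alone carries the bare region to the
    `q`-volume" (`representedVol_iff_ind3_gap`);
  - GENUINE negative instance `ValLine.not_represented_bareWitness`: for datum B (no (Ind3) enlargement,
    `LDHWitness` p406397) it FAILS for every pilot datum (`ln ν̄_𝕃(O_𝕃(−P_Θ)) = −deĝ̲_lgp(P_Θ) ≠ −deĝ̲(P_q)`,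
    the strict gap);
  - closed forms `OutputRegions.exists_represented` (over `ℚ`) / `OutputRegions.not_forall_represented` (also
    by ForkLana's own toy `cor312_not_imp_represented`).
* **F-1903** `LanaModel.MainGoal` ((9-1) at every point of a one-model record): BOTH conjunct-heads are ALREADY
  in the tree inside existentials of `ForkModelNonVacuity` (p424764) — `LanaModel.exists_mainGoal` (conj. 1)
  and `LanaModel.exists_indeterminacies_not_mainGoal` (conj. 2); restated bare here
  (`LanaModel.exists_mainGoal'`, `LanaModel.not_forall_mainGoal`) so the fold can cite head-matching names.

HONEST FRAMING: the valuation line has trivial (Ind2)/hull and identity (Ind1)-transport (LDHWitness scope note,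
referee ref-b PASS-B4): these theorems say (9-1)-as-representation is a genuine HYPOTHESIS on DH data whose truth
value is decided by what (Ind3) does to `O_𝕃(−P_Θ)` — nothing about the real tensor-packet containers and no
side on [IUTchIII] Cor. 3.12; deciding a FACT row = OUR kernel check of OUR typed predicate; typed ≠ proved.
[cite: LANA2026Report, §8.3 p. 43, §9.2–§9.3 p. 46, §10.5 p. 49] [cite: DupuyHilado2025, Thm. 3.10.1, §4.10–4.12]
[claim: Mochizuki2012, status: disputed]
-/

noncomputable section

namespace Summit.ABC.IUTFork

open Literature.IUT.LogVolume NumberField IsDedekindDomain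

/-! ## F-1898 `OutputRegions.Represented` at genuine valuation-line Dupuy–Hilado data -/

namespace ValLine

variable {F : Type} [Field F] [NumberField F] (X : PilotData F)

/-- **F-1898 — GENUINE positive instance (Reading 1 / (9-1) at volume level).** For datum Q
(`(O_𝕃(−P_Θ))^{Ind3} := O_𝕃(−P_q)`) the constructed Cor-3.12 setting has `RepresentedVol`: some possible image
(indeed every one) has the log-volume of the `q`-pilot image — because the (Ind3)-region IS `O_𝕃(−P_q)` and
(Ind1)/(Ind2) preserve `ln ν̄_𝕃` (`LDHCor312Skel.representedVol_iff` + DH Thm. 3.10.1 `lnνL_regionq`).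
[cite: LANA2026Report, §8.3 p. 43] [cite: DupuyHilado2025, Thm. 3.10.1, §4.10] -/
theorem representedVol_qWitness : (qWitness X).toSetting.RepresentedVol :=
  (DHData.representedVol_iff (qWitness X)).mpr (qWitness X).lnνL_regionq

/-- **F-1898 — the row's predicate itself at the genuine instance**: the real-number shadow
(`ForkLana.OutputRegions`) of datum Q's setting is REPRESENTED. [cite: LANA2026Report, §9.2–§9.3 p. 46] -/
theorem represented_qWitness : (qWitness X).toSetting.toOutputRegions.Represented :=
  ((qWitness X).toSetting.representedVol_iff).mp (representedVol_qWitness X)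

/-- **F-1898 — GENUINE negative instance.** For datum B (no (Ind3) enlargement) Reading 1 FAILS: the
(Ind3)-region is the bare `O_𝕃(−P_Θ)` with `ln ν̄_𝕃 = −deĝ̲_lgp(P_Θ) < −deĝ̲(P_q)` (DH Thm. 3.10.1 `lnνL_regionΘ` +
the strict gap `ndeg_qPilot_lt_ndegLgp_thetaPilot`). [cite: DupuyHilado2025, Thm. 3.10.1, §3.3] -/
theorem not_representedVol_bareWitness : ¬ (bareWitness X).toSetting.RepresentedVol := by
  intro h
  have h1 := (DHData.representedVol_iff (bareWitness X)).mp h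
  have h2 : (valLine F).lnνL X.lstar (primesUnder X) ((valLine F).region (tΘ X)) =
      -LgpDivisor.ndegLgp X.thetaPilot := (bareWitness X).lnνL_regionΘ
  have h3 : (valLine F).lnνL X.lstar (primesUnder X) ((valLine F).region (tΘ X)) =
      -FinDivisor.ndeg F X.qPilot := h1
  have h4 : FinDivisor.ndeg F X.qPilot < LgpDivisor.ndegLgp X.thetaPilot :=
    DHData.ndeg_qPilot_lt_ndegLgp_thetaPilot (bareWitness X)
  rw [h2] at h3
  linarith

/-- … hence the shadow of datum B's setting is NOT represented. [cite: LANA2026Report, §9.2–§9.3 p. 46] -/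
theorem not_represented_bareWitness : ¬ (bareWitness X).toSetting.toOutputRegions.Represented :=
  fun h => not_representedVol_bareWitness X (((bareWitness X).toSetting.representedVol_iff).mpr h)

end ValLine

namespace OutputRegions

/-- **F-1898 `OutputRegions.Represented` — instance form PROVED (genuine)**: over `ℚ` (pilot data of
`ValLine.exists_pilotData_rat`) the shadow of datum Q's constructed setting is represented.
[cite: LANA2026Report, §9.2–§9.3 p. 46] -/
theorem exists_represented : ∃ R : OutputRegions, R.Represented := by
  obtain ⟨X, -⟩ := ValLine.exists_pilotData_rat
  exact ⟨_, ValLine.represented_qWitness X⟩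

/-- **F-1898 — universal closure REFUTED** (genuinely by `ValLine.not_represented_bareWitness`; here in closed
form from this lineage's own toy `cor312_not_imp_represented`, ForkLana p403914: one region of volume `0`, hull
volume `1`, `−|log(q)| = 1/2`). [cite: LANA2026Report, §10.5 p. 49] -/
theorem not_forall_represented : ¬ ∀ R : OutputRegions, R.Represented := by
  obtain ⟨R, -, hR⟩ := cor312_not_imp_represented
  exact fun h => hR (h R)

/-- F-1898 decided both ways at genuine valuation-line data over `ℚ`, in one statement: (9-1)-as-representation
holds for datum Q and fails for datum B over the same pilot divisors — its truth value is what (Ind3) does to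
`O_𝕃(−P_Θ)`. [cite: LANA2026Report, §10.5 p. 49] [claim: Mochizuki2012, status: disputed] -/
theorem represented_independent : ∃ X : PilotData ℚ,
    (ValLine.qWitness X).toSetting.toOutputRegions.Represented ∧
      ¬ (ValLine.bareWitness X).toSetting.toOutputRegions.Represented := by
  obtain ⟨X, -⟩ := ValLine.exists_pilotData_rat
  exact ⟨X, ValLine.represented_qWitness X, ValLine.not_represented_bareWitness X⟩

end OutputRegions

/-! ## F-1903 `LanaModel.MainGoal` — bare restatements of ForkModelNonVacuity's existentials (p424764) -/

namespace LanaModel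

/-- **F-1903 `LanaModel.MainGoal` — instance form PROVED** (first conjunct of
`LanaModel.exists_mainGoal`, ForkModelNonVacuity p424764: a one-model record whose hull volume IS the `q`-volume
at every point). [cite: LANA2026Report, §9.2 (9-1) p. 46] -/
theorem exists_mainGoal' : ∃ M : LanaModel, M.MainGoal := by
  obtain ⟨M, hM, -, -⟩ := LanaModel.exists_mainGoal
  exact ⟨M, hM⟩

/-- **F-1903 — universal closure REFUTED** (second conjunct of `LanaModel.exists_indeterminacies_not_mainGoal`,
p424764: a record where the multiradial estimate holds and (9-1) fails). [cite: LANA2026Report, §10.5 p. 49] -/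
theorem not_forall_mainGoal : ¬ ∀ M : LanaModel, M.MainGoal := by
  obtain ⟨M, -, hM, -⟩ := LanaModel.exists_indeterminacies_not_mainGoal
  exact fun h => hM (h M)

end LanaModel

end Summit.ABC.IUTFork

end
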